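import Summits.Ventures.LatticeQCDFlow.Scoring.WilsonFlowRK3Rate
import HarnessLib

/-!
# Stability of the engine's RK3 integrator: one step is `(1 + Kε)`-Lipschitz, `m` steps at fixed flow time are `e^{Kt}`-Lipschitz, and per-step perturbations (round-off, re-unitarisation) accumulate at most linearly

HONEST FRAMING: exact (Metropolis-corrected) sampling algorithms for lattice gauge theory;
figures of merit are autocorrelation/cost numbers at stated couplings and volumes; no
continuum-physics claim.

Venture `LatticeQCDFlow` (cell pub-lqcd), sub-topic `Scoring`; FANOUT row 16 (`su2-base`: the flowed observables
are measured on `RK3_ε^m V`).  Sixth file of the RK3-CONVERGENCE packet (`OneStepMethodConvergence`: the discrete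
Grönwall recursion `discreteGronwall_le`; `WilsonFlowRK3LocalError`: `rk3Amb`, `rk3AmbDeriv`, `hasDerivAt_rk3Amb`,
`coeConfig_wilsonFlowRK3`; `WilsonFlowRK3Rate`: `contDiff_rk3AmbDeriv`, `dist_iterate_wilsonFlowRK3_le_div`;
row 30's `Scaling/FlowLipschitzBudget.dist_coeConfig`).  NEW WORK of the cell (placement rule); nothing is cited as a
fact; no number (constants existential).  Printed counterpart, NAMED ONLY: the stability half of the convergence
theory of one-step methods (Hairer–Nørsett–Wanner I §II.3; the "fundamental lemma" bounding the propagation of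
per-step perturbations); Lüscher, JHEP 08 (2010) 071, App. C.

The previous files compare the EXACT-arithmetic scheme with the exact flow.  What the engine computes differs from
`RK3_ε^m V` by per-step perturbations (floating point, the series cut-off in `m_exp`, optional re-unitarisation).
This file types the value-free statement that such perturbations cannot blow up: they are amplified by at most
`e^{K t}` at flow time `t` and accumulate at most linearly in the number of steps.

## What is here (every `d`, `n`, `L ≥ 1`)

* §1 **`dist_wilsonFlowRK3_le_lipschitz`** — there is `K ≥ 0` with
  `dist (RK3_ε U) (RK3_ε U') ≤ (1 + K ε) · dist U U'` for all `ε ∈ [0, 1]` and all configurations (the step is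
  `id + ∫₀^ε ∂_s RK3_s`, and `∂_s RK3_s` is Lipschitz in the field uniformly in `s ∈ [0,1]` by joint smoothness and
  compactness); **`dist_iterate_wilsonFlowRK3_le_exp`** — `m` steps are `e^{K m ε}`-Lipschitz:
  `dist (RK3_ε^m U) (RK3_ε^m U') ≤ e^{K m ε} dist U U'` (uniform in `m` at fixed flow time `t = m ε`).
* §2 **`dist_perturbed_iterate_le`** (abstract, any pseudo-metric space) — if `Φ` is `Λ`-Lipschitz with `Λ ≥ 1` and
  a sequence `x` satisfies `dist (x (k+1)) (Φ (x k)) ≤ δ` (per-step perturbation `δ`), then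
  `dist (x k) (Φ^[k] (x 0)) ≤ k δ Λ^k`; **`dist_perturbed_wilsonFlowRK3_le`** — for the engine's step:
  `dist (Ṽ k) (RK3_ε^k (Ṽ 0)) ≤ k δ e^{K k ε}`.
* §3 **`dist_perturbed_wilsonFlowRK3_wilsonFlow_le`** — TOTAL ERROR at fixed flow time `t ≥ 0`: there are `C, K`
  such that every `δ`-perturbed RK3 sequence with `m ≥ t` steps of size `t/m` satisfies
  `dist (Ṽ m) (wilsonFlow t (Ṽ 0)) ≤ C/m + m δ e^{K t}` — truncation `O(1/m)` plus accumulated perturbation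
  `O(m δ)`, for EVERY starting configuration.

NOT CLAIMED: any model of floating-point arithmetic (δ is a free parameter); the constants (existential, from
compactness at fixed `d`, `L`, `n` — no uniformity in the volume is claimed); any number.
-/

namespace Summit.Ventures.LatticeQCDFlow.Scoring

open Matrix Filter Topology Set Literature.MathematicalPhysics.QuantumFieldTheory
open Literature.MathematicalPhysics.QuantumFieldTheory.Luscher2010 (AmbConfig)
open Summit.Ventures.LatticeQCDFlow.Theory2.Lattice.SUN (dist_coeConfig)

open scoped Matrix.Norms.Frobenius NNReal

-- The scoped Frobenius instances are definitionally the product structures, but only at default transparency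
-- (as in Mathlib's `MatrixExponential` and `Scoring/WilsonFlowRK3Consistency`).
set_option backward.isDefEq.respectTransparency false

/-! ## §1 The step is `(1 + Kε)`-Lipschitz; `m` steps are `e^{Kmε}`-Lipschitz -/

section StepLipschitz

variable {d L n : ℕ} [NeZero L]

/-- The step-size derivative of the scheme is Lipschitz in the field, uniformly for `s ∈ [0, 1]`, on `SU(n)^E`
(joint `C¹` smoothness on the compact convex set `[0,1] × closedBall 0 ρ₀`). -/
theorem exists_lipschitz_rk3AmbDeriv :
    ∃ K : ℝ≥0, ∀ s ∈ Icc (0 : ℝ) 1, ∀ U U' : GaugeConfig d L (Matrix.specialUnitaryGroup (Fin n) ℂ),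
      ‖rk3AmbDeriv s (WilsonFlow.coeConfig U) - rk3AmbDeriv s (WilsonFlow.coeConfig U')‖ ≤ K * dist U U' := by
  have hS : IsCompact ((Icc (0 : ℝ) 1) ×ˢ Metric.closedBall (0 : AmbConfig d L n) (WilsonFlow.ρ₀ d L n)) :=
    isCompact_Icc.prod (isCompact_closedBall _ _)
  have hconv : Convex ℝ ((Icc (0 : ℝ) 1) ×ˢ Metric.closedBall (0 : AmbConfig d L n) (WilsonFlow.ρ₀ d L n)) :=
    (convex_Icc 0 1).prod (convex_closedBall _ _)
  obtain ⟨K, hK⟩ := (contDiff_rk3AmbDeriv (d := d) (L := L) (n := n) (m := 1)).contDiffOn.exists_lipschitzOnWith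
    one_ne_zero hconv hS
  refine ⟨K, fun s hs U U' => ?_⟩
  have hp : ((s, WilsonFlow.coeConfig U) : ℝ × AmbConfig d L n) ∈
      (Icc (0 : ℝ) 1) ×ˢ Metric.closedBall (0 : AmbConfig d L n) (WilsonFlow.ρ₀ d L n) :=
    ⟨hs, WilsonFlow.coeConfig_mem_closedBall U⟩
  have hq : ((s, WilsonFlow.coeConfig U') : ℝ × AmbConfig d L n) ∈
      (Icc (0 : ℝ) 1) ×ˢ Metric.closedBall (0 : AmbConfig d L n) (WilsonFlow.ρ₀ d L n) :=
    ⟨hs, WilsonFlow.coeConfig_mem_closedBall U'⟩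
  have h := hK.dist_le_mul _ hp _ hq
  rw [dist_eq_norm, Prod.dist_eq, dist_self, dist_coeConfig, max_eq_right dist_nonneg] at h
  exact h

/-- **One RK3 step is `(1 + Kε)`-Lipschitz on the configuration space**, for every `ε ∈ [0, 1]`:
`dist (RK3_ε U) (RK3_ε U') ≤ (1 + K ε) · dist U U'`. -/
theorem dist_wilsonFlowRK3_le_lipschitz :
    ∃ K : ℝ≥0, ∀ ε ∈ Icc (0 : ℝ) 1, ∀ U U' : GaugeConfig d L (Matrix.specialUnitaryGroup (Fin n) ℂ),
      dist (wilsonFlowRK3 ε U) (wilsonFlowRK3 ε U') ≤ (1 + K * ε) * dist U U' := by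
  obtain ⟨K, hK⟩ := exists_lipschitz_rk3AmbDeriv (d := d) (L := L) (n := n)
  refine ⟨K, fun ε hε U U' => ?_⟩
  -- `h(s) = rk3Amb s (coe U) − rk3Amb s (coe U')`, `h(0) = coe U − coe U'`, `‖h'(s)‖ ≤ K dist U U'`
  have hderiv : ∀ s ∈ Icc (0 : ℝ) ε, HasDerivWithinAt
      (fun s : ℝ => rk3Amb s (WilsonFlow.coeConfig U) - rk3Amb s (WilsonFlow.coeConfig U'))
      (rk3AmbDeriv s (WilsonFlow.coeConfig U) - rk3AmbDeriv s (WilsonFlow.coeConfig U')) (Icc 0 ε) s :=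
    fun s _ => ((hasDerivAt_rk3Amb s _).sub (hasDerivAt_rk3Amb s _)).hasDerivWithinAt
  have hbound : ∀ s ∈ Ico (0 : ℝ) ε,
      ‖rk3AmbDeriv s (WilsonFlow.coeConfig U) - rk3AmbDeriv s (WilsonFlow.coeConfig U')‖ ≤ K * dist U U' :=
    fun s hs => hK s ⟨hs.1, le_trans (le_of_lt hs.2) hε.2⟩ U U'
  have h := norm_image_sub_le_of_norm_deriv_le_segment' hderiv hbound ε ⟨hε.1, le_rfl⟩
  rw [rk3Amb_zero, rk3Amb_zero, sub_zero, ← coeConfig_wilsonFlowRK3, ← coeConfig_wilsonFlowRK3] at h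
  have htri : ‖WilsonFlow.coeConfig (wilsonFlowRK3 ε U) - WilsonFlow.coeConfig (wilsonFlowRK3 ε U')‖ ≤
      ‖WilsonFlow.coeConfig U - WilsonFlow.coeConfig U'‖ + K * dist U U' * ε := by
    have := norm_sub_le_norm_sub_add_norm_sub
      (WilsonFlow.coeConfig (wilsonFlowRK3 ε U) - WilsonFlow.coeConfig (wilsonFlowRK3 ε U'))
      (WilsonFlow.coeConfig U - WilsonFlow.coeConfig U') 0
    rw [sub_zero, sub_zero] at this
    linarith [norm_sub_rev (WilsonFlow.coeConfig (wilsonFlowRK3 ε U) - WilsonFlow.coeConfig (wilsonFlowRK3 ε U'))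
      (WilsonFlow.coeConfig U - WilsonFlow.coeConfig U')]
  rw [← dist_eq_norm, ← dist_eq_norm, dist_coeConfig, dist_coeConfig] at htri
  calc dist (wilsonFlowRK3 ε U) (wilsonFlowRK3 ε U') ≤ dist U U' + K * dist U U' * ε := htri
    _ = (1 + K * ε) * dist U U' := by ring

/-- **`m` steps are `e^{K m ε}`-Lipschitz**: `dist (RK3_ε^m U) (RK3_ε^m U') ≤ e^{K m ε} · dist U U'` for every
`ε ∈ [0, 1]`, `m`, `U`, `U'` — at fixed flow time `t = m ε` the discrete flow is `e^{Kt}`-Lipschitz uniformly in the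
number of steps (`1 + Kε ≤ e^{Kε}`). -/
theorem dist_iterate_wilsonFlowRK3_le_exp :
    ∃ K : ℝ≥0, ∀ ε ∈ Icc (0 : ℝ) 1, ∀ (m : ℕ) (U U' : GaugeConfig d L (Matrix.specialUnitaryGroup (Fin n) ℂ)),
      dist ((wilsonFlowRK3 ε)^[m] U) ((wilsonFlowRK3 ε)^[m] U') ≤ Real.exp (K * (m * ε)) * dist U U' := by
  obtain ⟨K, hK⟩ := dist_wilsonFlowRK3_le_lipschitz (d := d) (L := L) (n := n)
  refine ⟨K, fun ε hε m => ?_⟩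
  induction m with
  | zero =>
    intro U U'
    simp
  | succ m ih =>
    intro U U'
    rw [Function.iterate_succ_apply', Function.iterate_succ_apply']
    have h1 := hK ε hε ((wilsonFlowRK3 ε)^[m] U) ((wilsonFlowRK3 ε)^[m] U')
    have h2 := ih U U'
    have hKε : 1 + K * ε ≤ Real.exp (K * ε) := by
      have := Real.add_one_le_exp (K * ε)
      linarith
    calc dist (wilsonFlowRK3 ε ((wilsonFlowRK3 ε)^[m] U)) (wilsonFlowRK3 ε ((wilsonFlowRK3 ε)^[m] U'))
        ≤ (1 + K * ε) * dist ((wilsonFlowRK3 ε)^[m] U) ((wilsonFlowRK3 ε)^[m] U') := h1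
      _ ≤ Real.exp (K * ε) * (Real.exp (K * (m * ε)) * dist U U') :=
          mul_le_mul hKε h2 dist_nonneg (Real.exp_pos _).le
      _ = Real.exp (K * (((m + 1 : ℕ) : ℝ) * ε)) * dist U U' := by
          rw [← mul_assoc, ← Real.exp_add]
          push_cast
          ring_nf

end StepLipschitz

/-! ## §2 Per-step perturbations accumulate at most linearly -/

section Perturbed

/-- **Propagation of per-step perturbations** (any pseudo-metric space).  If `Φ` is `Λ`-Lipschitz with `Λ ≥ 1`
and the sequence `x` follows `Φ` up to `δ` at every step, `dist (x (k+1)) (Φ (x k)) ≤ δ`, then after `k` steps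
`dist (x k) (Φ^[k] (x 0)) ≤ k · δ · Λ^k` (the discrete Grönwall recursion `discreteGronwall_le`). -/
theorem dist_perturbed_iterate_le {X : Type*} [PseudoMetricSpace X] {Φ : X → X} {Λ δ : ℝ} (hΛ : 1 ≤ Λ)
    (hΦ : ∀ x y, dist (Φ x) (Φ y) ≤ Λ * dist x y) {x : ℕ → X} (hx : ∀ k, dist (x (k + 1)) (Φ (x k)) ≤ δ) (k : ℕ) :
    dist (x k) (Φ^[k] (x 0)) ≤ k * δ * Λ ^ k := by
  have hδ : 0 ≤ δ := le_trans dist_nonneg (hx 0)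
  refine discreteGronwall_le (e := fun k => dist (x k) (Φ^[k] (x 0))) hδ hΛ (by simp) (fun k => ?_) k
  rw [Function.iterate_succ_apply']
  calc dist (x (k + 1)) (Φ (Φ^[k] (x 0)))
      ≤ dist (x (k + 1)) (Φ (x k)) + dist (Φ (x k)) (Φ (Φ^[k] (x 0))) := dist_triangle _ _ _
    _ ≤ δ + Λ * dist (x k) (Φ^[k] (x 0)) := add_le_add (hx k) (hΦ _ _)

variable {d L n : ℕ} [NeZero L]

/-- **Perturbed RK3 sequences stay close to the exact-arithmetic iterates**: there is `K ≥ 0` such that for every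
`ε ∈ [0, 1]`, every `δ` and every sequence of configurations `Ṽ` with `dist (Ṽ (k+1)) (RK3_ε (Ṽ k)) ≤ δ` for all `k`
(per-step perturbation: round-off, exponential cut-off, re-unitarisation, …),
`dist (Ṽ k) (RK3_ε^k (Ṽ 0)) ≤ k · δ · e^{K k ε}`. -/
theorem dist_perturbed_wilsonFlowRK3_le :
    ∃ K : ℝ≥0, ∀ ε ∈ Icc (0 : ℝ) 1, ∀ (δ : ℝ) (V : ℕ → GaugeConfig d L (Matrix.specialUnitaryGroup (Fin n) ℂ)),
      (∀ k, dist (V (k + 1)) (wilsonFlowRK3 ε (V k)) ≤ δ) →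
        ∀ k : ℕ, dist (V k) ((wilsonFlowRK3 ε)^[k] (V 0)) ≤ k * δ * Real.exp (K * (k * ε)) := by
  obtain ⟨K, hK⟩ := dist_wilsonFlowRK3_le_lipschitz (d := d) (L := L) (n := n)
  refine ⟨K, fun ε hε δ V hV k => ?_⟩
  have hΛ : (1 : ℝ) ≤ 1 + K * ε := by
    have : (0 : ℝ) ≤ K * ε := mul_nonneg K.coe_nonneg hε.1
    linarith
  have h := dist_perturbed_iterate_le hΛ (hK ε hε) hV k
  have hδ : 0 ≤ δ := le_trans dist_nonneg (hV 0)
  have hpow : (1 + K * ε) ^ k ≤ Real.exp (K * (k * ε)) := by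
    have h1 : 1 + K * ε ≤ Real.exp (K * ε) := by
      have := Real.add_one_le_exp (K * ε)
      linarith
    have h0 : (0 : ℝ) ≤ 1 + K * ε := by
      have : (0 : ℝ) ≤ K * ε := mul_nonneg K.coe_nonneg hε.1
      linarith
    calc (1 + K * ε) ^ k ≤ Real.exp (K * ε) ^ k := pow_le_pow_left₀ h0 h1 k
      _ = Real.exp (K * (k * ε)) := by rw [← Real.exp_nat_mul]; ring_nf
  calc dist (V k) ((wilsonFlowRK3 ε)^[k] (V 0)) ≤ k * δ * (1 + K * ε) ^ k := h
    _ ≤ k * δ * Real.exp (K * (k * ε)) := mul_le_mul_of_nonneg_left hpow (mul_nonneg (Nat.cast_nonneg k) hδ)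

end Perturbed

/-! ## §3 Total error at fixed flow time: truncation plus accumulated perturbation -/

section Total

variable {d L n : ℕ} [NeZero L]

/-- **Total error of a perturbed RK3 computation of the Wilson flow.**  For every flow time `t ≥ 0` there are
constants `C, K ≥ 0` such that for every `m ≥ t`, every per-step tolerance `δ` and every sequence of configurations
`Ṽ 0, …, Ṽ m` with `dist (Ṽ (k+1)) (RK3_{t/m} (Ṽ k)) ≤ δ`,
`dist (Ṽ m) (wilsonFlow t (Ṽ 0)) ≤ C/m + m δ e^{K t}`: the truncation error of the scheme
(`dist_iterate_wilsonFlowRK3_le_div`) plus the linearly accumulated, exponentially-in-`t` amplified perturbations. -/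
theorem dist_perturbed_wilsonFlowRK3_wilsonFlow_le {t : ℝ} (ht : 0 ≤ t) :
    ∃ C K : ℝ, 0 ≤ C ∧ 0 ≤ K ∧ ∀ m : ℕ, t ≤ m →
      ∀ (δ : ℝ) (V : ℕ → GaugeConfig d L (Matrix.specialUnitaryGroup (Fin n) ℂ)),
        (∀ k, dist (V (k + 1)) (wilsonFlowRK3 (t / m) (V k)) ≤ δ) →
          dist (V m) (wilsonFlow t (V 0)) ≤ C / m + m * δ * Real.exp (K * t) := by
  obtain ⟨C, hC0, hC⟩ := dist_iterate_wilsonFlowRK3_le_div (d := d) (L := L) (n := n) ht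
  obtain ⟨K, hK⟩ := dist_perturbed_wilsonFlowRK3_le (d := d) (L := L) (n := n)
  refine ⟨C, K, hC0, K.coe_nonneg, fun m hm δ V hV => ?_⟩
  rcases Nat.eq_zero_or_pos m with h0 | hmpos
  · subst h0
    have ht0 : t = 0 := le_antisymm (by simpa using hm) ht
    subst ht0
    simp [wilsonFlow_zero]
  · have hmR : (0 : ℝ) < m := Nat.cast_pos.mpr hmpos
    have hε : t / m ∈ Icc (0 : ℝ) 1 := ⟨div_nonneg ht hmR.le, (div_le_one hmR).mpr hm⟩
    have hmt : (m : ℝ) * (t / m) = t := mul_div_cancel₀ t (ne_of_gt hmR)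
    have h1 := hK (t / m) hε δ V hV m
    rw [hmt] at h1
    have h2 := hC m hm (V 0)
    calc dist (V m) (wilsonFlow t (V 0))
        ≤ dist (V m) ((wilsonFlowRK3 (t / m))^[m] (V 0)) + dist ((wilsonFlowRK3 (t / m))^[m] (V 0)) (wilsonFlow t (V 0)) :=
          dist_triangle _ _ _
      _ ≤ m * δ * Real.exp (K * t) + C / m := add_le_add h1 h2
      _ = C / m + m * δ * Real.exp (K * t) := add_comm _ _

end Total

end Summit.Ventures.LatticeQCDFlow.Scoring
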